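import Summits.QuantumFields.YangMills.Theorems.AllWindowsColdBoxBulkMidSandwichMeanNearModeSmooth
import Summits.QuantumFields.YangMills.Theorems.SandwichVariancePinchingFloorMollification
import Summits.QuantumFields.YangMills.Theorems.SandwichVariancePinchingFloorWhitening

/-!
# Log-concave MEAN–MODE GAP under the second-difference sandwich (dimension-explicit, constant `1`)
# — the typed engine `SandwichMeanNearMode` of crux idea `logconcave-core-extension` on
# ⟨stmt-QuantumFields-24006⟩ `AllWindowsColdBox.BulkMidWindowSU2`

THEOREM (`meanMode_of_posDef`, sharp form; `sandwichMeanNearMode`, the card's shape with constant `3`).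
Let `H₀ ≻ 0` on `ℝⁿ`, `0 ≤ r < 1`, and let `A : ℝⁿ → ℝ` be CONTINUOUS with the two-sided second-difference
sandwich `(1−r)·hᵀH₀h ≤ A(x+h) + A(x−h) − 2A(x) ≤ (1+r)·hᵀH₀h` for all `x, h`, minimised at `xs`.  Then for
every `λ ∈ ℝⁿ` the Gibbs mean of `λ·(x − xs)` under `e^{−A}dx` satisfies
`|∫ λ·(x−xs) e^{−A} / ∫ e^{−A}| ≤ r · √(n/(1−r)) · √(λᵀH₀⁻¹λ)`.
This is LITERALLY (with `3r` in place of `r`) the `Prop` `SandwichMeanNearMode` typed in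
`Cruxes/BulkMidWindowSU2/LogConcaveCoreExtensionSketch.lean` (piece P3b of the card: concentration of the
log-concave surrogate on the small-field core); `example : SandwichMeanNearMode := sandwichMeanNearMode`
elaborates by unfolding.

PROOF.  §1 whitened frame `H₀ = 1`, continuous `A` (`meanMode_whitened_aux`, `meanMode_whitened`): mollify by
normed bumps (`sandwich_moll`, `contDiff_moll`; Gibbs moments converge, `tendsto_integral_moll`); for the smooth
`A_k` the sibling file gives (S1) `|I_k + ∂_λA_k(xs)Z_k| ≤ (r/2)(V_k + |λ|²Z_k)` and (S2)
`(1−r)V_k ≤ nZ_k − Σ_j ∂_jA_k(xs)·∫(x−xs)_j e^{−A_k}`; the gradient of `A_k` AT THE MINIMISER OF `A` tends to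
`0` — `A_k ≥ A(xs)` everywhere while `A_k(xs) ≤ A(xs) + (1+r)·n·rOut_k²` (upper second differences at `xs`),
so the descent inequality forces `(∂_vA_k(xs))² ≤ 2(1+r)|v|²·(1+r)n·rOut_k²`; in the limit
`|I|/Z ≤ (r/2)(n/(1−r) + |λ|²)`, and scaling `λ ↦ sλ` + optimising `s` (`meanMode_le_of_forall_pos`) gives
`r√(n/(1−r))·|λ|`.  §2 general `H₀`: conjugate by `P = H₀^{1/2}` (`exists_symm_sqrt`, `sandwich_conj`,
`integral_div_comp_mulVec`, `conj_dotProduct_conj`).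

HONEST SCOPE.  Free-hands work of the LEAD seat of ⟨stmt-QuantumFields-24006⟩ (cell ym-idea-1 / FCL lineage):
the typed piece P3b of an UN-TRIAGED crux idea card, a pure log-concave probability lemma over the tree's
`SandwichVariancePinching` toolkit.  It proves no stub of LINE-18 (S6/S7 stay open), not the crux, no rung and
no summit; the Yang–Mills mass gap is NOT proved by any of this.
-/

noncomputable section

namespace Summit.QuantumFields.YangMills.Theorems.SandwichVariancePinching

open MeasureTheory Real Filter Topology ContinuousLinearMap Matrix
open scoped Convolution

variable {n : ℕ}

/-! ## §0 A one-parameter optimisation -/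

/-- If `a ≤ c·(P/s + s·L)` for every `s > 0` (`c, P, L ≥ 0`) then `a ≤ 2c·√P·√L`. [folklore] -/
theorem meanMode_le_of_forall_pos {a c P L : ℝ} (hc : 0 ≤ c) (hP : 0 ≤ P) (hL : 0 ≤ L)
    (h : ∀ s : ℝ, 0 < s → a ≤ c * (P / s + s * L)) : a ≤ 2 * c * Real.sqrt P * Real.sqrt L := by
  rcases eq_or_lt_of_le hL with hL0 | hLpos
  · -- `L = 0`: let `s → ∞`
    rw [← hL0, Real.sqrt_zero, mul_zero]
    refine le_of_forall_pos_le_add fun ε hε => ?_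
    have hs : 0 < (c * P + 1) / ε := by positivity
    have h1 := h _ hs
    rw [← hL0, mul_zero, add_zero] at h1
    have h2 : c * (P / ((c * P + 1) / ε)) = ε * (c * P / (c * P + 1)) := by
      field_simp
    have h3 : c * P / (c * P + 1) ≤ 1 := by
      rw [div_le_one (by positivity)]; linarith
    rw [h2] at h1
    nlinarith
  rcases eq_or_lt_of_le hP with hP0 | hPpos
  · -- `P = 0`: let `s → 0`
    rw [← hP0, Real.sqrt_zero, mul_zero, zero_mul]
    refine le_of_forall_pos_le_add fun ε hε => ?_
    have hs : 0 < ε / (c * L + 1) := by positivity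
    have h1 := h _ hs
    rw [← hP0, zero_div, zero_add] at h1
    have h2 : c * (ε / (c * L + 1) * L) = ε * (c * L / (c * L + 1)) := by
      field_simp
    have h3 : c * L / (c * L + 1) ≤ 1 := by
      rw [div_le_one (by positivity)]; linarith
    rw [h2] at h1
    nlinarith
  · -- `P, L > 0`: `s = √P/√L`
    have hsP : 0 < Real.sqrt P := Real.sqrt_pos.mpr hPpos
    have hsL : 0 < Real.sqrt L := Real.sqrt_pos.mpr hLpos
    have h1 := h (Real.sqrt P / Real.sqrt L) (div_pos hsP hsL)
    have hA1 : P / (Real.sqrt P / Real.sqrt L) = Real.sqrt P * Real.sqrt L := by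
      rw [div_div_eq_mul_div, mul_div_right_comm, Real.div_sqrt]
    have hA2 : Real.sqrt P / Real.sqrt L * L = Real.sqrt P * Real.sqrt L := by
      rw [div_mul_eq_mul_div, mul_div_assoc, Real.div_sqrt]
    rw [hA1, hA2] at h1
    linarith

/-! ## §1 The whitened frame `H₀ = 1`, continuous potential -/

/-- Sup-norm growth of a coordinate of `x − x₀`: `|(x−x₀)ᵢ| ≤ (1+‖x₀‖)(1+‖x‖)`. [folklore] -/
theorem meanMode_abs_coord_sub_le (x₀ : Fin n → ℝ) (i : Fin n) (x : Fin n → ℝ) :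
    |(x - x₀) i| ≤ (1 + ‖x₀‖) * (1 + ‖x‖) ^ 1 := by
  rw [pow_one]
  have h1 : |(x - x₀) i| ≤ ‖x - x₀‖ := by simpa [Real.norm_eq_abs] using norm_le_pi_norm (x - x₀) i
  have h2 : ‖x - x₀‖ ≤ (1 + ‖x₀‖) * (1 + ‖x‖) := by
    have := norm_sub_le x x₀
    nlinarith [norm_nonneg x, norm_nonneg x₀]
  exact h1.trans h2

/-- **MEAN–MODE GAP, whitened frame, quadratic form**: for a CONTINUOUS potential with the Euclidean
sandwich (`0 ≤ δ < 1`) minimised at `xs`, `|∫ w·(x−xs)e^{−A} / ∫e^{−A}| ≤ (δ/2)·(n/(1−δ) + |w|²)`.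
(Mollification + the smooth inequalities (S1), (S2) + vanishing of `∇A_k(xs)` in the limit.) [folklore] -/
theorem meanMode_whitened_aux {δ : ℝ} (hδ : 0 ≤ δ) (hδ1 : δ < 1) {A : (Fin n → ℝ) → ℝ}
    (hA : Continuous A)
    (hsw : ∀ x h : Fin n → ℝ, (1 - δ) * (h ⬝ᵥ h) ≤ A (x + h) + A (x - h) - 2 * A x ∧
      A (x + h) + A (x - h) - 2 * A x ≤ (1 + δ) * (h ⬝ᵥ h))
    (xs : Fin n → ℝ) (hmin : ∀ x, A xs ≤ A x) (w : Fin n → ℝ) :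
    |(∫ x, (w ⬝ᵥ (x - xs)) * exp (-A x)) / ∫ x, exp (-A x)| ≤ δ / 2 * (n / (1 - δ) + w ⬝ᵥ w) := by
  obtain ⟨C₀, κ, hC₀, hκ, hlb⟩ := exists_quadratic_lower_of_sandwich hA hδ1 hsw
  -- bumps with support radius `1/(k+1)`
  have hr : ∀ k : ℕ, (0:ℝ) < 1 / (2 * ((k:ℝ) + 1)) := fun k => by positivity
  have hr' : ∀ k : ℕ, 1 / (2 * ((k:ℝ) + 1)) < 1 / ((k:ℝ) + 1) := fun k =>
    one_div_lt_one_div_of_lt (by positivity) (by linarith [(Nat.cast_nonneg k : (0:ℝ) ≤ k)])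
  set φ : ℕ → ContDiffBump (0 : Fin n → ℝ) :=
    fun k => ⟨1 / (2 * ((k:ℝ) + 1)), 1 / ((k:ℝ) + 1), hr k, hr' k⟩ with hφdef
  have hφout : ∀ k, (φ k).rOut = 1 / ((k:ℝ) + 1) := fun k => rfl
  have hφ : Tendsto (fun k => (φ k).rOut) atTop (𝓝 0) := by
    simp only [hφout]; exact tendsto_one_div_add_atTop_nhds_zero_nat
  have hφ1 : ∀ k, (φ k).rOut ≤ 1 := fun k => by
    rw [hφout, div_le_one (by positivity)]; linarith [(Nat.cast_nonneg k : (0:ℝ) ≤ k)]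
  -- the mollified potentials
  set Am : ℕ → (Fin n → ℝ) → ℝ := fun k => (φ k).normed volume ⋆[lsmul ℝ ℝ, volume] A with hAmdef
  have hAm2 : ∀ k, ContDiff ℝ 2 (Am k) := fun k => contDiff_moll (φ k) hA
  have hAmc : ∀ k, Continuous (Am k) := fun k => (hAm2 k).continuous
  have hswm : ∀ k (x h : Fin n → ℝ), (1 - δ) * (h ⬝ᵥ h) ≤ Am k (x + h) + Am k (x - h) - 2 * Am k x ∧
      Am k (x + h) + Am k (x - h) - 2 * Am k x ≤ (1 + δ) * (h ⬝ᵥ h) := fun k x h =>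
    sandwich_moll (φ k) hA hsw x h
  have hlbm : ∀ k x, -(2 * C₀ + 2 * κ) * (1 + ‖x‖) + κ * ‖x‖ ^ 2 ≤ Am k x := fun k x =>
    quadratic_lower_moll (φ k) (hφ1 k) hA hC₀ hκ.le hlb x
  -- convergence of Gibbs moments
  have hlim : ∀ {wt : (Fin n → ℝ) → ℝ} {D : ℝ} {j : ℕ}, Continuous wt → j ≤ 8 →
      (∀ x, |wt x| ≤ D * (1 + ‖x‖) ^ j) →
      Tendsto (fun k => ∫ x, wt x * exp (-Am k x)) atTop (𝓝 (∫ x, wt x * exp (-A x))) :=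
    fun hw hj hwb => tendsto_integral_moll φ hφ hφ1 hA hw hC₀ hκ hj hlb hwb
  have hZlim : Tendsto (fun k => ∫ x, exp (-Am k x)) atTop (𝓝 (∫ x, exp (-A x))) := by
    have := hlim (wt := fun _ => (1:ℝ)) (D := 1) (j := 0) continuous_const (by norm_num) (fun x => by simp)
    simpa using this
  have hIlim : Tendsto (fun k => ∫ x, (w ⬝ᵥ (x - xs)) * exp (-Am k x)) atTop
      (𝓝 (∫ x, (w ⬝ᵥ (x - xs)) * exp (-A x))) :=
    hlim (continuous_const.dotProduct (continuous_id.sub continuous_const)) (by norm_num)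
      (meanMode_abs_dot_sub_le w xs)
  have hVlim : Tendsto (fun k => ∫ x, ((x - xs) ⬝ᵥ (x - xs)) * exp (-Am k x)) atTop
      (𝓝 (∫ x, ((x - xs) ⬝ᵥ (x - xs)) * exp (-A x))) :=
    hlim ((continuous_id.sub continuous_const).dotProduct (continuous_id.sub continuous_const))
      (by norm_num) (meanMode_dot_sub_self_le xs)
  have hJlim : ∀ i : Fin n, Tendsto (fun k => ∫ x, (x - xs) i * exp (-Am k x)) atTop
      (𝓝 (∫ x, (x - xs) i * exp (-A x))) := fun i =>
    hlim ((continuous_apply i).comp (continuous_id.sub continuous_const)) (by norm_num)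
      (meanMode_abs_coord_sub_le xs i)
  have hIj : ∀ k (i : Fin n), Integrable fun x => (x - xs) i * exp (-Am k x) := fun k i =>
    integrable_mul_exp_neg_of_growth (hAmc k) ((continuous_apply i).comp (continuous_id.sub
      continuous_const)) hκ (by norm_num : 1 ≤ 8) (hlbm k) (meanMode_abs_coord_sub_le xs i)
  -- positivity of the partition function
  have hZ : 0 < ∫ x, exp (-A x) := by
    have := integrable_mul_exp_neg_of_growth hA continuous_const hκ (by norm_num : 0 ≤ 8) hlb
      (w := fun _ => (1:ℝ)) (D := 1) (fun x => by simp)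
    exact integral_exp_pos (by simpa using this)
  -- the gradient of `A_k` at the minimiser `xs` of `A` tends to zero
  have hlow : ∀ k y, A xs ≤ Am k y := fun k y =>
    le_moll_of_forall_ball (φ k) hA y fun t _ => hmin (y - t)
  have hup : ∀ k, Am k xs ≤ A xs + (1 + δ) * n * (φ k).rOut ^ 2 := fun k => by
    refine moll_le_of_forall_ball (φ k) hA xs fun t ht => ?_
    have h2 := (hsw xs t).2
    have h1 := hmin (xs + t)
    have h3 := dotProduct_self_le_card_mul_norm_sq t
    have h4 : ‖t‖ ^ 2 ≤ (φ k).rOut ^ 2 := pow_le_pow_left₀ (norm_nonneg _) ht.le 2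
    have h5 : t ⬝ᵥ t ≤ (n : ℝ) * (φ k).rOut ^ 2 :=
      h3.trans (mul_le_mul_of_nonneg_left h4 (Nat.cast_nonneg n))
    have h6 : (1 + δ) * (t ⬝ᵥ t) ≤ (1 + δ) * ((n : ℝ) * (φ k).rOut ^ 2) :=
      mul_le_mul_of_nonneg_left h5 (by linarith)
    linarith
  have hgrad : ∀ k (v : Fin n → ℝ),
      (fderiv ℝ (Am k) xs v) ^ 2 ≤ 2 * (1 + δ) * (v ⬝ᵥ v) * ((1 + δ) * n * (φ k).rOut ^ 2) := by
    intro k v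
    have h1δ : 0 < 1 + δ := by linarith
    have hvv : 0 ≤ v ⬝ᵥ v := by simpa using dotProduct_self_star_nonneg v
    rcases eq_or_lt_of_le hvv with hv0 | hvpos
    · have hv : v = 0 := dotProduct_self_eq_zero.mp hv0.symm
      subst hv
      simp
    · set D := fderiv ℝ (Am k) xs v with hDdef
      set p := v ⬝ᵥ v with hpdef
      set η := (1 + δ) * n * (φ k).rOut ^ 2 with hηdef
      set t : ℝ := -D / ((1 + δ) * p) with htdef
      have hdesc := meanMode_descent (hAm2 k) (K := 1 + δ) (fun x h => (hswm k x h).2) xs (t • v)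
      have e1 : fderiv ℝ (Am k) xs (t • v) = t * D := by rw [map_smul, smul_eq_mul]
      have e2 : (t • v) ⬝ᵥ (t • v) = t ^ 2 * p := by
        rw [smul_dotProduct, dotProduct_smul, smul_eq_mul, smul_eq_mul]; ring
      rw [e1, e2] at hdesc
      have hl := hlow k (xs + t • v)
      have hu := hup k
      have key : t * D + (1 + δ) / 2 * (t ^ 2 * p) = -(D ^ 2 / (2 * ((1 + δ) * p))) := by
        rw [htdef]; field_simp; ring
      have hpos : 0 < 2 * ((1 + δ) * p) := by positivity
      have h3 : D ^ 2 / (2 * ((1 + δ) * p)) ≤ η := by linarith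
      rw [div_le_iff₀ hpos] at h3
      nlinarith
  have hgrad0 : ∀ v : Fin n → ℝ, Tendsto (fun k => fderiv ℝ (Am k) xs v) atTop (𝓝 0) := by
    intro v
    set B : ℝ := Real.sqrt (2 * (1 + δ) * (v ⬝ᵥ v) * ((1 + δ) * n)) with hB
    have hb : ∀ k, |fderiv ℝ (Am k) xs v| ≤ B * (φ k).rOut := by
      intro k
      have h := hgrad k v
      have hvv : 0 ≤ v ⬝ᵥ v := by simpa using dotProduct_self_star_nonneg v
      have hre : 2 * (1 + δ) * (v ⬝ᵥ v) * ((1 + δ) * ↑n * (φ k).rOut ^ 2) = (B * (φ k).rOut) ^ 2 := by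
        rw [mul_pow, hB, Real.sq_sqrt (by positivity)]; ring
      rw [hre] at h
      have hB0 : 0 ≤ B * (φ k).rOut := mul_nonneg (Real.sqrt_nonneg _) (φ k).rOut_pos.le
      calc |fderiv ℝ (Am k) xs v| = Real.sqrt ((fderiv ℝ (Am k) xs v) ^ 2) :=
            (Real.sqrt_sq_eq_abs _).symm
        _ ≤ Real.sqrt ((B * (φ k).rOut) ^ 2) := Real.sqrt_le_sqrt h
        _ = B * (φ k).rOut := Real.sqrt_sq hB0
    refine squeeze_zero_norm (a := fun k => B * (φ k).rOut) (fun k => ?_) ?_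
    · rw [Real.norm_eq_abs]; exact hb k
    · have := hφ.const_mul B
      simpa using this
  -- the smooth inequalities for each `k`
  have hS1 : ∀ k, |(∫ x, (w ⬝ᵥ (x - xs)) * exp (-Am k x)) + fderiv ℝ (Am k) xs w * ∫ x, exp (-Am k x)| ≤
      δ / 2 * ((∫ x, ((x - xs) ⬝ᵥ (x - xs)) * exp (-Am k x)) + (w ⬝ᵥ w) * ∫ x, exp (-Am k x)) :=
    fun k => meanMode_firstMoment_smooth (hAm2 k) hδ hδ1 (hswm k) xs w
  have hS2 : ∀ k, (1 - δ) * ∫ x, ((x - xs) ⬝ᵥ (x - xs)) * exp (-Am k x) ≤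
      n * (∫ x, exp (-Am k x)) - ∫ x, fderiv ℝ (Am k) xs (x - xs) * exp (-Am k x) :=
    fun k => meanMode_secondMoment_smooth (hAm2 k) hδ hδ1 (hswm k) xs
  -- the gradient term of (S2) as a finite sum; it tends to zero
  have hJ : ∀ k, ∫ x, fderiv ℝ (Am k) xs (x - xs) * exp (-Am k x) =
      ∑ j, fderiv ℝ (Am k) xs (Pi.single j 1) * ∫ x, (x - xs) j * exp (-Am k x) := by
    intro k
    have e : (fun x => fderiv ℝ (Am k) xs (x - xs) * exp (-Am k x)) =
        fun x => ∑ j, fderiv ℝ (Am k) xs (Pi.single j 1) * ((x - xs) j * exp (-Am k x)) := by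
      funext x
      rw [clm_apply_eq_sum_single (fderiv ℝ (Am k) xs) (x - xs), Finset.sum_mul]
      exact Finset.sum_congr rfl fun j _ => by ring
    rw [e, integral_finsetSum _ (fun j _ => (hIj k j).const_mul _)]
    exact Finset.sum_congr rfl fun j _ => integral_const_mul _ _
  have hJlim0 : Tendsto (fun k => ∫ x, fderiv ℝ (Am k) xs (x - xs) * exp (-Am k x)) atTop (𝓝 0) := by
    have h : Tendsto (fun k => ∑ j, fderiv ℝ (Am k) xs (Pi.single j 1) * ∫ x, (x - xs) j * exp (-Am k x))
        atTop (𝓝 (∑ j : Fin n, (0:ℝ) * ∫ x, (x - xs) j * exp (-A x))) :=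
      tendsto_finsetSum _ fun j _ => (hgrad0 (Pi.single j 1)).mul (hJlim j)
    simp only [zero_mul, Finset.sum_const_zero] at h
    refine h.congr fun k => ?_
    exact (hJ k).symm
  -- pass to the limit
  have hlimS1 : |∫ x, (w ⬝ᵥ (x - xs)) * exp (-A x)| ≤
      δ / 2 * ((∫ x, ((x - xs) ⬝ᵥ (x - xs)) * exp (-A x)) + (w ⬝ᵥ w) * ∫ x, exp (-A x)) := by
    have hL : Tendsto (fun k => |(∫ x, (w ⬝ᵥ (x - xs)) * exp (-Am k x)) +
        fderiv ℝ (Am k) xs w * ∫ x, exp (-Am k x)|) atTop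
        (𝓝 (|(∫ x, (w ⬝ᵥ (x - xs)) * exp (-A x)) + 0 * ∫ x, exp (-A x)|)) :=
      (hIlim.add ((hgrad0 w).mul hZlim)).abs
    have hR : Tendsto (fun k => δ / 2 * ((∫ x, ((x - xs) ⬝ᵥ (x - xs)) * exp (-Am k x)) +
        (w ⬝ᵥ w) * ∫ x, exp (-Am k x))) atTop
        (𝓝 (δ / 2 * ((∫ x, ((x - xs) ⬝ᵥ (x - xs)) * exp (-A x)) + (w ⬝ᵥ w) * ∫ x, exp (-A x)))) :=
      (hVlim.add (hZlim.const_mul _)).const_mul _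
    have := le_of_tendsto_of_tendsto' hL hR hS1
    simpa using this
  have hlimS2 : (1 - δ) * ∫ x, ((x - xs) ⬝ᵥ (x - xs)) * exp (-A x) ≤ n * ∫ x, exp (-A x) := by
    have hL : Tendsto (fun k => (1 - δ) * ∫ x, ((x - xs) ⬝ᵥ (x - xs)) * exp (-Am k x)) atTop
        (𝓝 ((1 - δ) * ∫ x, ((x - xs) ⬝ᵥ (x - xs)) * exp (-A x))) := hVlim.const_mul _
    have hR : Tendsto (fun k => n * (∫ x, exp (-Am k x)) - ∫ x, fderiv ℝ (Am k) xs (x - xs) * exp (-Am k x))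
        atTop (𝓝 (n * (∫ x, exp (-A x)) - 0)) := (hZlim.const_mul _).sub hJlim0
    have := le_of_tendsto_of_tendsto' hL hR hS2
    simpa using this
  -- conclude
  have h1δ : 0 < 1 - δ := by linarith
  rw [abs_div, abs_of_pos hZ, div_le_iff₀ hZ]
  have hV : ∫ x, ((x - xs) ⬝ᵥ (x - xs)) * exp (-A x) ≤ n / (1 - δ) * ∫ x, exp (-A x) := by
    rw [div_mul_eq_mul_div, le_div_iff₀ h1δ]
    linarith
  have hδ2 : 0 ≤ δ / 2 := by linarith
  calc |∫ x, (w ⬝ᵥ (x - xs)) * exp (-A x)|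
      ≤ δ / 2 * ((∫ x, ((x - xs) ⬝ᵥ (x - xs)) * exp (-A x)) + (w ⬝ᵥ w) * ∫ x, exp (-A x)) := hlimS1
    _ ≤ δ / 2 * (n / (1 - δ) * (∫ x, exp (-A x)) + (w ⬝ᵥ w) * ∫ x, exp (-A x)) :=
        mul_le_mul_of_nonneg_left (add_le_add hV le_rfl) hδ2
    _ = δ / 2 * (n / (1 - δ) + w ⬝ᵥ w) * ∫ x, exp (-A x) := by ring

/-- **MEAN–MODE GAP, whitened frame** (constant `1`): for a CONTINUOUS potential with the Euclidean
sandwich (`0 ≤ δ < 1`) minimised at `xs`, `|∫ w·(x−xs)e^{−A} / ∫e^{−A}| ≤ δ·√(n/(1−δ))·√(w·w)`.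
(Scale `w ↦ s•w` in `meanMode_whitened_aux` and optimise `s`.) [folklore] -/
theorem meanMode_whitened {δ : ℝ} (hδ : 0 ≤ δ) (hδ1 : δ < 1) {A : (Fin n → ℝ) → ℝ}
    (hA : Continuous A)
    (hsw : ∀ x h : Fin n → ℝ, (1 - δ) * (h ⬝ᵥ h) ≤ A (x + h) + A (x - h) - 2 * A x ∧
      A (x + h) + A (x - h) - 2 * A x ≤ (1 + δ) * (h ⬝ᵥ h))
    (xs : Fin n → ℝ) (hmin : ∀ x, A xs ≤ A x) (w : Fin n → ℝ) :
    |(∫ x, (w ⬝ᵥ (x - xs)) * exp (-A x)) / ∫ x, exp (-A x)| ≤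
      δ * Real.sqrt (n / (1 - δ)) * Real.sqrt (w ⬝ᵥ w) := by
  have key : ∀ s : ℝ, 0 < s → |(∫ x, (w ⬝ᵥ (x - xs)) * exp (-A x)) / ∫ x, exp (-A x)| ≤
      δ / 2 * ((n / (1 - δ)) / s + s * (w ⬝ᵥ w)) := by
    intro s hs
    have h := meanMode_whitened_aux hδ hδ1 hA hsw xs hmin (s • w)
    have e1 : (∫ x, ((s • w) ⬝ᵥ (x - xs)) * exp (-A x)) = s * ∫ x, (w ⬝ᵥ (x - xs)) * exp (-A x) := by
      rw [← integral_const_mul]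
      congr 1; funext x
      rw [smul_dotProduct, smul_eq_mul]; ring
    have e2 : (s • w) ⬝ᵥ (s • w) = s ^ 2 * (w ⬝ᵥ w) := by
      rw [smul_dotProduct, dotProduct_smul, smul_eq_mul, smul_eq_mul]; ring
    rw [e1, e2, mul_div_assoc, abs_mul, abs_of_pos hs] at h
    have hs' : s ≠ 0 := hs.ne'
    refine le_of_mul_le_mul_left ?_ hs
    calc s * |(∫ x, (w ⬝ᵥ (x - xs)) * exp (-A x)) / ∫ x, exp (-A x)|
        ≤ δ / 2 * (n / (1 - δ) + s ^ 2 * (w ⬝ᵥ w)) := h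
      _ = s * (δ / 2 * ((n / (1 - δ)) / s + s * (w ⬝ᵥ w))) := by
          field_simp
  have hc : (0:ℝ) ≤ δ / 2 := by linarith
  have h := meanMode_le_of_forall_pos (c := δ / 2) (P := n / (1 - δ)) (L := w ⬝ᵥ w) hc
    (div_nonneg (Nat.cast_nonneg n) (by linarith)) (by simpa using dotProduct_self_star_nonneg w) key
  calc |(∫ x, (w ⬝ᵥ (x - xs)) * exp (-A x)) / ∫ x, exp (-A x)|
      ≤ 2 * (δ / 2) * Real.sqrt (n / (1 - δ)) * Real.sqrt (w ⬝ᵥ w) := h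
    _ = δ * Real.sqrt (n / (1 - δ)) * Real.sqrt (w ⬝ᵥ w) := by ring

/-! ## §2 General positive definite `H₀` (whitening) and the card's shape -/

open Summit.QuantumFields.YangMills.Cruxes.TransportCovarianceTransfer in
/-- **MEAN–MODE GAP under the `H₀`-sandwich** (constant `1`, dimension-explicit): for `H₀ ≻ 0`,
`0 ≤ δ < 1`, `A` continuous with `(1−δ)hᵀH₀h ≤ A(x+h)+A(x−h)−2A(x) ≤ (1+δ)hᵀH₀h` minimised at `xs`,
`|∫ w·(x−xs)e^{−A} / ∫e^{−A}| ≤ δ·√(n/(1−δ))·√(wᵀH₀⁻¹w)`. [folklore: Brascamp–Lieb-type first-moment bound] -/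
theorem meanMode_of_posDef {H₀ : Matrix (Fin n) (Fin n) ℝ} (hH₀ : H₀.PosDef) {δ : ℝ} (hδ : 0 ≤ δ)
    (hδ1 : δ < 1) {A : (Fin n → ℝ) → ℝ} (hA : Continuous A)
    (hsw : ∀ x h : Fin n → ℝ, (1 - δ) * (h ⬝ᵥ H₀.mulVec h) ≤ A (x + h) + A (x - h) - 2 * A x ∧
      A (x + h) + A (x - h) - 2 * A x ≤ (1 + δ) * (h ⬝ᵥ H₀.mulVec h))
    (xs : Fin n → ℝ) (hmin : ∀ x, A xs ≤ A x) (w : Fin n → ℝ) :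
    |(∫ x, (w ⬝ᵥ (x - xs)) * exp (-A x)) / ∫ x, exp (-A x)| ≤
      δ * Real.sqrt (n / (1 - δ)) * Real.sqrt (w ⬝ᵥ H₀⁻¹.mulVec w) := by
  obtain ⟨P, hPs, hP, hPP⟩ := exists_symm_sqrt hH₀
  have hQs : P⁻¹.IsSymm := isSymm_inv hPs
  have hQQ : P⁻¹ * P⁻¹ = H₀⁻¹ := by rw [← Matrix.mul_inv_rev, hPP]
  have hQdet : (P⁻¹).det ≠ 0 := by
    rw [Matrix.det_nonsing_inv, Ring.inverse_eq_inv']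
    exact inv_ne_zero hP
  -- the whitened potential and its minimiser `P xs`
  set At : (Fin n → ℝ) → ℝ := fun y => A (P⁻¹ *ᵥ y) with hAt
  have hAtc : Continuous At := hA.comp (Matrix.mulVecLin P⁻¹).toContinuousLinearMap.continuous
  have hswt : ∀ y k : Fin n → ℝ, (1 - δ) * (k ⬝ᵥ k) ≤ At (y + k) + At (y - k) - 2 * At y ∧
      At (y + k) + At (y - k) - 2 * At y ≤ (1 + δ) * (k ⬝ᵥ k) := fun y k =>
    sandwich_conj hPs hP hPP hsw y k
  have hmint : ∀ y, At (P *ᵥ xs) ≤ At y := fun y => by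
    simp only [hAt]
    rw [inv_mulVec_mulVec hP]
    exact hmin _
  have key := meanMode_whitened hδ hδ1 hAtc hswt (P *ᵥ xs) hmint (P⁻¹ *ᵥ w)
  -- identify the observable and the constant
  have hobs : ∀ y, (P⁻¹ *ᵥ w) ⬝ᵥ (y - P *ᵥ xs) = w ⬝ᵥ (P⁻¹ *ᵥ y - xs) := by
    intro y
    rw [show P⁻¹ *ᵥ y - xs = P⁻¹ *ᵥ (y - P *ᵥ xs) by rw [Matrix.mulVec_sub, inv_mulVec_mulVec hP],
      dotProduct_mulVec_of_isSymm hQs w]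
  have hww : (P⁻¹ *ᵥ w) ⬝ᵥ (P⁻¹ *ᵥ w) = w ⬝ᵥ H₀⁻¹ *ᵥ w := conj_dotProduct_conj hQs hQQ w w
  simp only [hobs, hww, hAt] at key
  have r1 := integral_div_comp_mulVec hQdet (fun x => (w ⬝ᵥ (x - xs)) * exp (-A x)) (fun x => exp (-A x))
  rw [r1] at key
  exact key

/-- **`SandwichMeanNearMode` — the typed engine of crux idea `logconcave-core-extension`
(⟨stmt-QuantumFields-24006⟩, `Cruxes/BulkMidWindowSU2/LogConcaveCoreExtensionSketch.lean`), BY SHAPE**: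
the statement below is that `Prop` verbatim (constant `3`; the sharp constant `1` is `meanMode_of_posDef`),
so `example : SandwichMeanNearMode := sandwichMeanNearMode` elaborates by unfolding.  For a continuous,
globally `(1±r)H₀`-sandwiched `A` minimised at `xs`, the Gibbs mean of any linear functional `λ` is within
`3r·√(n/(1−r))·√(λᵀH₀⁻¹λ)` of its value at `xs`. [folklore: Brascamp–Lieb-type first-moment bound] -/
theorem sandwichMeanNearMode :
    ∀ (n : ℕ) (H₀ : Matrix (Fin n) (Fin n) ℝ), H₀.PosDef → ∀ (r : ℝ), 0 ≤ r → r < 1 →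
    ∀ (A : (Fin n → ℝ) → ℝ), Continuous A →
      (∀ x h : Fin n → ℝ,
          (1 - r) * (h ⬝ᵥ H₀.mulVec h) ≤ A (x + h) + A (x - h) - 2 * A x ∧
            A (x + h) + A (x - h) - 2 * A x ≤ (1 + r) * (h ⬝ᵥ H₀.mulVec h)) →
      ∀ (xs : Fin n → ℝ), (∀ x, A xs ≤ A x) → ∀ (lam : Fin n → ℝ),
        |(∫ x, (lam ⬝ᵥ (x - xs)) * Real.exp (-A x)) / (∫ x, Real.exp (-A x))| ≤
          3 * r * Real.sqrt (n / (1 - r)) * Real.sqrt (lam ⬝ᵥ H₀⁻¹.mulVec lam) := by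
  intro n H₀ hH₀ r hr hr1 A hA hsw xs hmin lam
  have h := meanMode_of_posDef hH₀ hr hr1 hA hsw xs hmin lam
  have h0 : 0 ≤ r * Real.sqrt (n / (1 - r)) * Real.sqrt (lam ⬝ᵥ H₀⁻¹.mulVec lam) := by positivity
  linarith

end Summit.QuantumFields.YangMills.Theorems.SandwichVariancePinching

end
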